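import Summits.Ventures.PackingBounds.Configurations.IntegerCodes

/-!
# Certified Coulomb-energy UPPER bounds for integer-point configurations (kernel-checkable)

Framing: lottery ticket; floor = certified bounds/negative ranges. Venture `PackingBounds` (cell `pub-packcert`, seat
`pub-packcert-energy`, gen 26) — attained-side infrastructure, companion of `IntegerCodes.lean`.

A configuration is a list `L` of integer points `(x, w)`, `x·x = w²`, `w > 0` (unit vectors `x/w ∈ ℝⁿ`, `IntCode.code`).
For the Coulomb / Riesz-`1` energy `Σ_{x ≠ y} 1/‖x - y‖` (ordered pairs) a table `U` of natural numbers and a scale `M`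
pass the Boolean check `coulombOK L U M` iff for all positions `i ≠ j`: `U_ij > 0` and
`M² · w_i w_j ≤ U_ij² · (2 w_i w_j - 2 x_i·x_j)` — i.e. `(M/U_ij)² ≤ 2 - 2⟪x_i/w_i, x_j/w_j⟫ = ‖x_i/w_i - x_j/w_j‖²`, so
`1/‖x_i/w_i - x_j/w_j‖ ≤ U_ij/M`. Hence (`coulomb_energy_le`, `exists_config_coulomb_le`) the configuration's Coulomb
energy is at most `(Σ_{i ≠ j} U_ij)/M`, a rational number that `decide` evaluates on explicit data. All checks run by
`decide`; no floating point enters the kernel. Use: certified UPPER bounds for Thomson-type minima from numerically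
found configurations snapped to rational points of the sphere (stereographic rounding), e.g.
`Configurations/DiploSimplexSmallDimensions.lean` (the diplo-simplex is not Coulomb-optimal for `n = 3, 4`).
-/

namespace Summit.Ventures.PackingBounds.Config.IntCode

open Finset WithLp Summit.Ventures.PackingBounds.Config

/-- Coulomb bound-table check: for all positions `i ≠ j`, `0 < U_ij` and `M²·(w_i w_j) ≤ U_ij²·(2 w_i w_j - 2 x_i·x_j)`. -/
def coulombOK (L : List (List ℤ × ℤ)) (U : List (List ℕ)) (M : ℕ) : Bool :=
  (List.range L.length).all fun i => (List.range L.length).all fun j =>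
    i == j || (decide (0 < (U.getD i []).getD j 0) &&
      decide (((M : ℤ) ^ 2) * ((L.getD i ([], 0)).2 * (L.getD j ([], 0)).2) ≤
        (((U.getD i []).getD j 0 : ℕ) : ℤ) ^ 2 *
          (2 * ((L.getD i ([], 0)).2 * (L.getD j ([], 0)).2) - 2 * dotL (L.getD i ([], 0)).1 (L.getD j ([], 0)).1)))

variable {n : ℕ} {L : List (List ℤ × ℤ)} {num : ℤ} {den : ℕ} {U : List (List ℕ)} {M : ℕ}

/-- The Coulomb check at two distinct positions. -/
theorem of_coulombOK (hC : coulombOK L U M = true) (i j : Fin L.length) (hij : i ≠ j) :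
    0 < (U.getD i []).getD j 0 ∧
      ((M : ℤ) ^ 2) * ((L.get i).2 * (L.get j).2) ≤
        (((U.getD i []).getD j 0 : ℕ) : ℤ) ^ 2 * (2 * ((L.get i).2 * (L.get j).2) - 2 * dotL (L.get i).1 (L.get j).1) := by
  simp only [coulombOK, List.all_eq_true, List.mem_range, Bool.or_eq_true, beq_iff_eq, Bool.and_eq_true,
    decide_eq_true_eq] at hC
  have h := hC i.1 i.2 j.1 j.2
  rcases h with h | h
  · exact absurd (Fin.ext h) hij
  · rwa [List.getD_eq_getElem _ _ i.2, List.getD_eq_getElem _ _ j.2, ← List.get_eq_getElem,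
      ← List.get_eq_getElem] at h

/-- With `num < den` the attached unit vectors are pairwise distinct (injectivity of `i ↦ x_i/w_i`). -/
theorem injective_pt (hS : sphereOK L n = true) (hP : pairsOK L num den = true) (hden : 0 < den)
    (hlt : num < den) : Function.Injective fun i : Fin L.length => pt n (L.get i) := by
  intro i j hij
  by_contra hne
  have h := inner_pt_le hS hP hden i j hne
  simp only at hij
  rw [hij, real_inner_self_eq_norm_sq, norm_pt hS (List.get_mem L j), one_pow] at h
  have hd : (0 : ℝ) < den := by exact_mod_cast hden
  have : (num : ℝ) < den := by exact_mod_cast hlt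
  rw [le_div_iff₀ hd] at h
  linarith

/-- Per-pair bound: `1/‖x_i/w_i - x_j/w_j‖ ≤ U_ij / M`. -/
theorem inv_norm_sub_le (hS : sphereOK L n = true) (hP : pairsOK L num den = true) (hden : 0 < den)
    (hlt : num < den) (hC : coulombOK L U M = true) (hM : 0 < M) (i j : Fin L.length) (hij : i ≠ j) :
    1 / ‖pt n (L.get i) - pt n (L.get j)‖ ≤ (((U.getD i []).getD j 0 : ℕ) : ℝ) / M := by
  obtain ⟨hli, _, hwi⟩ := of_sphereOK hS (List.get_mem L i)
  obtain ⟨hlj, _, hwj⟩ := of_sphereOK hS (List.get_mem L j)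
  obtain ⟨hU, hle⟩ := of_coulombOK hC i j hij
  have hwi' : (0 : ℝ) < (L.get i).2 := by exact_mod_cast hwi
  have hwj' : (0 : ℝ) < (L.get j).2 := by exact_mod_cast hwj
  have hM' : (0 : ℝ) < M := by exact_mod_cast hM
  have hU' : (0 : ℝ) < (((U.getD i []).getD j 0 : ℕ) : ℝ) := by exact_mod_cast hU
  have hne : pt n (L.get i) ≠ pt n (L.get j) := fun h => hij (injective_pt hS hP hden hlt h)
  have hpos : 0 < ‖pt n (L.get i) - pt n (L.get j)‖ := norm_pos_iff.2 (sub_ne_zero.2 hne)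
  -- ‖x_i - x_j‖² = 2 - 2 t, t = d/(w_i w_j)
  have hsq : ‖pt n (L.get i) - pt n (L.get j)‖ ^ 2 =
      2 - 2 * (((dotL (L.get i).1 (L.get j).1 : ℤ) : ℝ) / (((L.get i).2 : ℝ) * ((L.get j).2 : ℝ))) := by
    rw [norm_sub_sq_real, norm_pt hS (List.get_mem L i), norm_pt hS (List.get_mem L j), inner_pt _ _ hli hlj]
    ring
  have hle' : ((M : ℝ) ^ 2) * (((L.get i).2 : ℝ) * ((L.get j).2 : ℝ)) ≤
      (((U.getD i []).getD j 0 : ℕ) : ℝ) ^ 2 *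
        (2 * (((L.get i).2 : ℝ) * ((L.get j).2 : ℝ)) - 2 * ((dotL (L.get i).1 (L.get j).1 : ℤ) : ℝ)) := by
    exact_mod_cast hle
  -- (M/U)² ≤ ‖x_i - x_j‖²
  have hww : (0 : ℝ) < ((L.get i).2 : ℝ) * ((L.get j).2 : ℝ) := mul_pos hwi' hwj'
  have hkey : ((M : ℝ) / (((U.getD i []).getD j 0 : ℕ) : ℝ)) ^ 2 ≤ ‖pt n (L.get i) - pt n (L.get j)‖ ^ 2 := by
    rw [hsq, div_pow, div_le_iff₀ (by positivity)]
    have : (2 - 2 * (((dotL (L.get i).1 (L.get j).1 : ℤ) : ℝ) / (((L.get i).2 : ℝ) * ((L.get j).2 : ℝ)))) *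
        (((U.getD i []).getD j 0 : ℕ) : ℝ) ^ 2 =
        ((((U.getD i []).getD j 0 : ℕ) : ℝ) ^ 2 *
          (2 * (((L.get i).2 : ℝ) * ((L.get j).2 : ℝ)) - 2 * ((dotL (L.get i).1 (L.get j).1 : ℤ) : ℝ))) /
          (((L.get i).2 : ℝ) * ((L.get j).2 : ℝ)) := by
      field_simp
    rw [this, le_div_iff₀ hww]
    exact hle'
  have hle2 : (M : ℝ) / (((U.getD i []).getD j 0 : ℕ) : ℝ) ≤ ‖pt n (L.get i) - pt n (L.get j)‖ := by
    have h0 : 0 ≤ (M : ℝ) / (((U.getD i []).getD j 0 : ℕ) : ℝ) := by positivity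
    nlinarith [hkey, hpos, h0]
  rw [div_le_div_iff₀ hpos hM', one_mul]
  rw [div_le_iff₀ hU'] at hle2
  linarith

open scoped Classical in
/-- **Certified Coulomb-energy upper bound.** If `L` passes `sphereOK`, `pairsOK num den` (`num < den`) and
`coulombOK L U M` (`M > 0`), then `Σ_{x ≠ y ∈ code} 1/‖x - y‖ ≤ (Σ_{i ≠ j} U_ij)/M`. -/
theorem coulomb_energy_le (hS : sphereOK L n = true) (hP : pairsOK L num den = true) (hden : 0 < den)
    (hlt : num < den) (hC : coulombOK L U M = true) (hM : 0 < M) :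
    ∑ x ∈ code n L, ∑ y ∈ (code n L).erase x, 1 / ‖x - y‖ ≤
      ((∑ i : Fin L.length, ∑ j ∈ (univ : Finset (Fin L.length)).erase i, (U.getD i []).getD j 0 : ℕ) : ℝ) / M := by
  have hinj := injective_pt hS hP hden hlt
  rw [code, sum_image fun i _ j _ h => hinj h]
  push_cast
  rw [Finset.sum_div]
  refine sum_le_sum fun i _ => ?_
  rw [← image_erase hinj, sum_image fun a _ b _ h => hinj h, Finset.sum_div]
  exact sum_le_sum fun j hj => inv_norm_sub_le hS hP hden hlt hC hM i j (ne_of_mem_erase hj).symm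

open scoped Classical in
/-- **Packaging.** Such a list gives `|L|` unit vectors of `ℝⁿ` with Coulomb energy (ordered pairs) at most
`(Σ_{i ≠ j} U_ij)/M`. -/
theorem exists_config_coulomb_le (hS : sphereOK L n = true) (hP : pairsOK L num den = true) (hden : 0 < den)
    (hlt : num < den) (hC : coulombOK L U M = true) (hM : 0 < M) :
    ∃ C : Finset (EuclideanSpace ℝ (Fin n)), C.card = L.length ∧ (∀ x ∈ C, ‖x‖ = 1) ∧
      ∑ x ∈ C, ∑ y ∈ C.erase x, 1 / ‖x - y‖ ≤
        ((∑ i : Fin L.length, ∑ j ∈ (univ : Finset (Fin L.length)).erase i, (U.getD i []).getD j 0 : ℕ) : ℝ) / M :=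
  ⟨code n L, card_eq hS hP hden hlt, norm_eq_one hS, coulomb_energy_le hS hP hden hlt hC hM⟩

end Summit.Ventures.PackingBounds.Config.IntCode
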